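import Summits.AtomisticToContinuum.Crystallization.Theorems.FrustratedLawDichotomyStrainedPatchHomValueT2Track

/-!
# G5′ TRACK edition, part 2 (price levers): the first-edition track leaf, the FUSED near evaluator with integer-prefiltered label lists, the force floor
# (27623 `(H) HomFloor`, hcp half, E-piece NEAR boxes; decomp-a2c hand-1 g48 — NEARGATE5-hand-1-g48 §6; critic rows 1654 (S4)(e) walls / (C2)(ε3′), 1657 PRICE-THIN-49)

Split from `…HomValueT2Track` for the 400-line cap.  §15 `t2ReportT1` (edition-1 `t2Data` restricted to the graph), §16 `preLabels`/`nearAf`/`nearBf` (exact integer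
prefilter: `σ_U = 1 − ‖U − 1‖_F`, `3|p_b|² = 3b₀² + 3b₁² + 3b₀b₁ + 8b₂²`) + `passNear`/`t2NearT(W)` (ONE record pass: single-segment value model with full-box value
hulls for every block, restricted to the graph as in §13, and the §14b slope accumulator), §17 `t2ForceT` (force FLOOR on a track-following shuffle cell).
DEFINITIONS ONLY (computable; tree imports + part 1); soundness = (I1)-type debts, NOT claimed.  0 sorry; no instances / notation / `#eval`.
`--supports stmt-AtomisticToContinuum-27623`.
-/

namespace Summit.AtomisticToContinuum.Crystallization.Theorems.FrustratedLawDichotomyStrainedPatchHomValueT2Kit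

open Literature.Analysis.ValidatedNumerics.Numerics
open Summit.AtomisticToContinuum.Crystallization.Theorems.FrustratedLawDichotomyStrainedPatchHomEntryGram (cen rad)
open Summit.AtomisticToContinuum.Crystallization.Theorems.FrustratedLawDichotomyStrainedPatchHomEntryGramHcp (shufFI dot3)
open Summit.AtomisticToContinuum.Crystallization.Theorems.FrustratedLawDichotomyStrainedPatchHomCurvLeaf (boxLabels7)
open Summit.AtomisticToContinuum.Crystallization.Theorems.FrustratedLawDichotomyStrainedPatchHomCurvCentreKit (boxE cenE cenX)

/-! ## §15. The FIRST-EDITION track leaf (price lever): value hulls of the Hessian blocks, no third derivatives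

The first-edition leaf `t2Report` (…HomValueT2Kit §5–§7: `t2Data` = `UU` block hull over the FULL box, `Uξ`/`ξξ` block hulls over `U_c × Ξ`, gradient at the point with
its transport radius; inequality `E(x) ≥ V₀ + g^c·δ + ½δᵀH^cδ − Σ gr_k|δ_k| − ½Σ Hr_kl|δ_k||δ_l|` on the product box via the three linear paths (i)(ii)(iii)) also holds at
every graph point `x = (U, σU)` (both legs `(U_c, η_c) → (U_c, σU) → (U, σU)` stay in the track product box).  Its penalties are `O(h³)` on the own-hE boxes like
Design J's, with a larger constant, but its per-label record (`mkRec`: `y, q, α, β, Uᵀy, z`) has NO derivative tables — the price lever measured in NEARGATE5 §6.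
Restriction = §13 verbatim on the interval data rebuilt from `(cen, rad)`. -/

/-- Rebuild the interval array `[c − r, c + r]` from a centre/radius pair of integer arrays (first `n` entries). -/
def ivArr (n : ℕ) (c r : Array ℤ) : Array FI := Array.ofFn fun i : Fin n => ⟨c.getD i.val 0 - r.getD i.val 0, c.getD i.val 0 + r.getD i.val 0⟩

/-- The first-edition track report given the centre value option (shared by the fixed-window and windowed editions). -/
def t2TrackCore1 (vo : Option ℤ) (μ : ℤ) (c w : (Fin 3 × Fin 3) ⊕ Fin 3 → ℤ) (aP : Fin 3 → Fin 6 → ℤ) : Bool × ℤ × ℤ × ℤ × ℤ × ℤ :=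
  let w' := trackW aP w
  let T := t2Data c w'
  let HT := hessTrack aP (ivArr 81 T.Hc T.Hr)
  let gT := gradTrack aP (ivArr 9 T.gc T.gr)
  let Hc : Array ℤ := HT.map cen
  let Hr : Array ℤ := HT.map rad
  let gc : Array ℤ := gT.map cen
  let gr : Array ℤ := gT.map rad
  let wu := wfU T.wf
  match vo, kappaShift Hc with
  | some v, some κ =>
    let t := anchor Hc gc wu 40
    let bm := boxMin Hc gc wu κ t
    let pP : ℤ := cdiv ((List.range 9).foldl (fun s k => s + gr.getD k 0 * wu.getD k 0) 0) (SC : ℤ) +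
      cdiv ((List.range 9).foldl (fun s k => (List.range 9).foldl (fun s2 l => s2 + (Hr.getD (9 * k + l) 0) * wu.getD k 0 * wu.getD l 0) s) 0)
        (2 * (SC : ℤ) * (SC : ℤ))
    (foldGuard c w' && T.ok && symOK Hc, v - μ, bm, pP, κ, v + bm - pP - μ)
  | some v, none => (false, v - μ, 0, 0, -1, 0)
  | none, _ => (false, 0, 0, 0, 0, 0)

/-- ★★ **FIRST-EDITION TRACK REPORT** `t2ReportT1 μ c w aP = (flag, V₀ − μ, boxMin₆, pen, κ, LB − μ)` in `SC` units: `pen` = the restricted hull radii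
`Σ g̃r_e w_e + ½ Σ H̃r_{ee'} w_e w_{e'}` (gradient transport + Hessian value hulls, after restriction to the graph); `LB ≤ min_{U ∈ box} E(U, σU)`. -/
def t2ReportT1 (μ : ℤ) (c w : (Fin 3 × Fin 3) ⊕ Fin 3 → ℤ) (aP : Fin 3 → Fin 6 → ℤ) : Bool × ℤ × ℤ × ℤ × ℤ × ℤ :=
  t2TrackCore1 (valueP μ c) μ c w aP

/-- ★★ **FIRST-EDITION TRACK REPORT, windowed value.** -/
def t2ReportT1W (win : ℤ) (n : ℕ) (μ : ℤ) (c w : (Fin 3 × Fin 3) ⊕ Fin 3 → ℤ) (aP : Fin 3 → Fin 6 → ℤ) : Bool × ℤ × ℤ × ℤ × ℤ × ℤ :=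
  t2TrackCore1 (valuePW win n μ c) μ c w aP

/-! ## §16. The FUSED near evaluator (price lever L1 + L3′): prefiltered label lists, ONE record pass for value AND slope

One visit per label: box record `Rb = mkDRec top EF q` and point record `Rp = mkDRec top EP q`; from them (i) the single-segment value model on the track product
box — point gradient `g ∋ ∇E(x_c)` (point widths), Hessian VALUE HULL over the full product box `H ∈ Σ_b hessOf Rb` (all blocks; integral form of Taylor-2 along
the segment `x_c → (U, σU)`, which lies in the box), i.e. `E(x) ≥ V₀ + g^c·δ + ½δᵀH^cδ − Σ gr|δ| − ½Σ Hr|δ||δ|` (the first-edition inequality with full-box hulls for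
every block), restricted to the graph as in §13; (ii) the §14b slope accumulator (B family).  Label lists: the landed `nearA`/`nearB` FI filter, preceded by an exact
INTEGER prefilter (`preLabels`): with `σ_U := 1 − ‖U − 1‖_F ≤ σ_min(U)` from the entry box and `‖q‖ ≥ |p_b| − |s| − |ξ|` (`|s| = 1`), a label with
`σ_U(|p_b| − 1 − |ξ|_max) ≥ 9/2` (`B`) resp. `σ_U|p_b| ≥ 9/2` (`A`) has `ρ ≥ 9/2` on the whole box, hence `W₄₅ ≡ 0` there — it is dropped before any interval
arithmetic (`3|p_b|² = 3b₀² + 3b₁² + 3b₀b₁ + 8b₂²` exactly). -/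

/-- `3·|p_b|²` as an exact integer (`|f₀| = |f₁| = 1`, `f₀·f₁ = 1/2`, `|f₂|² = 8/3`, `f₂ ⊥ f₀, f₁`). -/
def hexNormSq3 (b : Fin 3 → ℤ) : ℤ := 3 * b 0 ^ 2 + 3 * b 1 ^ 2 + 3 * b 0 * b 1 + 8 * b 2 ^ 2

/-- `⌈‖U − 1‖_F·SC⌉` over the entry box: `⌈√(Σ_ab (|c_ab − δ_ab·SC| + w_ab)²)⌉`. -/
def froDevI (c w : (Fin 3 × Fin 3) ⊕ Fin 3 → ℤ) : ℤ :=
  let t : ℕ := (List.range 9).foldl (fun s n =>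
    let a : Fin 3 := ⟨n / 3 % 3, by omega⟩
    let b : Fin 3 := ⟨n % 3, by omega⟩
    s + ((|c (Sum.inl (a, b)) - (if a = b then (SC : ℤ) else 0)| + w (Sum.inl (a, b))).natAbs) ^ 2) 0
  (natSqrtUp t : ℤ)

/-- `⌈|ξ|_max·SC⌉` over the shuffle box: `⌈√(Σ_i (|c_i| + w_i)²)⌉`. -/
def xiMaxI (c w : (Fin 3 × Fin 3) ⊕ Fin 3 → ℤ) : ℤ :=
  let t : ℕ := (List.range 3).foldl (fun s n =>
    let i : Fin 3 := ⟨n % 3, by omega⟩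
    s + ((|c (Sum.inr i)| + w (Sum.inr i)).natAbs) ^ 2) 0
  (natSqrtUp t : ℤ)

/-- ★ **Integer prefilter** of the label candidates (`shifted = true` for the `B` family): keep `b` iff `3|p_b|²·SC² < 3·R²`, `R = ⌈(9/2)SC²/σ_U⌉ (+ SC + |ξ|_max
for `B`)`, `σ_U = SC − froDevI`; no prefilter (all of `boxLabels7`) when `σ_U ≤ SC/2`. -/
def preLabels (shifted : Bool) (c w : (Fin 3 × Fin 3) ⊕ Fin 3 → ℤ) : List (Fin 3 → ℤ) :=
  let sU := (SC : ℤ) - froDevI c w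
  if sU ≤ (SC : ℤ) / 2 then boxLabels7
  else
    let R : ℤ := cdiv (9 * (SC : ℤ) * (SC : ℤ)) (2 * sU) + (if shifted then (SC : ℤ) + xiMaxI c w else 0)
    boxLabels7.filter fun b => decide (hexNormSq3 b * ((SC : ℤ) * (SC : ℤ)) < 3 * R * R)

/-- ★ Prefiltered `A`-family near list (then the landed FI test of `nearA`). -/
def nearAf (c w : (Fin 3 × Fin 3) ⊕ Fin 3 → ℤ) : List (Fin 3 → ℤ) :=
  let E := boxE c w
  (preLabels false c w).filter fun b =>
    let y := tab3 (yOf E (tab3 (pA b)))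
    decide (b 0 ≠ 0 ∨ b 1 ≠ 0 ∨ b 2 ≠ 0) && decide ((dot3 y y).lo < farQ.hi)

/-- ★ Prefiltered `B`-family near list (then the landed FI test of `nearB`). -/
def nearBf (c w : (Fin 3 × Fin 3) ⊕ Fin 3 → ℤ) : List (Fin 3 → ℤ) :=
  let E := boxE c w
  let X := shufFI c w
  (preLabels true c w).filter fun b =>
    let y := tab3 (yOf E (tab3 (qB X b)))
    decide ((dot3 y y).lo < farQ.hi)

/-- Fused accumulator: guard, summed box-hull Hessian (81, FI), summed point gradient (9, FI), slope accumulator. -/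
structure AccN where
  /-- dispatch guard -/
  ok : Bool
  /-- `Σ_b hessOf Rb` (value hull over the product box, all blocks) -/
  H : Array FI
  /-- `Σ_b ∇E_b(x_c)` folded -/
  g : Array FI
  /-- §14b slope accumulator (`B` family) -/
  S : AccS

/-- ★ **THE FUSED NEAR PASS**: one visit per label of both families. -/
def passNear (c w' : (Fin 3 × Fin 3) ⊕ Fin 3 → ℤ) (aP : Fin 3 → Fin 6 → ℤ) (wf : Array ℤ) (LA LB : List (Fin 3 → ℤ)) : AccN :=
  let EF := boxE c w'
  let XF := shufFI c w'
  let EP := cenE c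
  let XP := cenX c
  let A0 : AccN := ⟨true, zeroArr 81, zeroArr 9, ⟨true, zeroArr 3, zeroArr 18, Array.replicate 3 0, Array.replicate 3 0⟩⟩
  let A1 := LA.foldl (fun A b =>
    match mkDRec 6 EF (pA b), mkDRec 6 EP (pA b) with
    | some Rb, some Rp =>
      let gb : Array FI := Array.ofFn fun a : Fin 9 => if 6 ≤ a.val then fi0 else Rp.co.be.mul (Rp.z a.val)
      ⟨A.ok, addArr 81 A.H (hessOf Rb true), addArr 9 A.g gb, A.S⟩
    | _, _ => ⟨false, A.H, A.g, A.S⟩) A0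
  LB.foldl (fun A b =>
    match mkDRec 9 EF (qB XF b), mkDRec 9 EP (qB XP b) with
    | some Rb, some Rp =>
      let gb : Array FI := Array.ofFn fun a : Fin 9 => Rp.co.be.mul (Rp.z a.val)
      ⟨A.ok, addArr 81 A.H (hessOf Rb false), addArr 9 A.g gb, accSlope aP wf Rp Rb A.S⟩
    | _, _ => ⟨false, A.H, A.g, A.S⟩) A1

/-- ★★★ **THE FUSED NEAR REPORT** `t2NearTW win n μ c w aP = ((flag, V₀ − μ, boxMin₆, pen, κ, LB − μ), (G₀, G₁, G₂))` in `SC` units — the single-segment value leaf at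
the track (hull penalties `pen = Σ g̃r w + ½ Σ H̃r w w` after restriction) and the §14b slope components, from ONE label pass over the prefiltered lists; value by
`valuePW win n`. -/
def t2NearTW (win : ℤ) (n : ℕ) (μ : ℤ) (c w : (Fin 3 × Fin 3) ⊕ Fin 3 → ℤ) (aP : Fin 3 → Fin 6 → ℤ) :
    (Bool × ℤ × ℤ × ℤ × ℤ × ℤ) × (ℤ × ℤ × ℤ) :=
  let w' := trackW aP w
  let LA := nearAf c w'
  let LB := nearBf c w'
  let wf : Array ℤ := Array.ofFn fun p : Fin 9 => foldW w' p
  let wu := wfU wf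
  let N := passNear c w' aP wf LA LB
  let HT := hessTrack aP N.H
  let gT := gradTrack aP N.g
  let Hc : Array ℤ := HT.map cen
  let Hr : Array ℤ := HT.map rad
  let gc : Array ℤ := gT.map cen
  let gr : Array ℤ := gT.map rad
  -- slope components (as in `t2SlopeT2`)
  let f := fun (a : ℕ) => (N.S.fc.getD a fi0).absHi
  let j := fun (a : ℕ) => cdiv ((List.range 6).foldl (fun s e => s + (N.S.jc.getD (6 * a + e) fi0).absHi * wf.getD e 0) 0) (SC : ℤ)
  let h := fun (a : ℕ) => cdiv (N.S.hp.getD a 0) (SC : ℤ)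
  let r := fun (a : ℕ) => cdiv (N.S.rp.getD a 0) (2 * (SC : ℤ))
  let G := fun (a : ℕ) => f a + j a + h a + r a
  let okAll := foldGuard c w' && N.ok && N.S.ok && symOK Hc
  match valuePW win n μ c, kappaShift Hc with
  | some v, some κ =>
    let t := anchor Hc gc wu 40
    let bm := boxMin Hc gc wu κ t
    let pP : ℤ := cdiv ((List.range 9).foldl (fun s k => s + gr.getD k 0 * wu.getD k 0) 0) (SC : ℤ) +
      cdiv ((List.range 9).foldl (fun s k => (List.range 9).foldl (fun s2 l => s2 + (Hr.getD (9 * k + l) 0) * wu.getD k 0 * wu.getD l 0) s) 0)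
        (2 * (SC : ℤ) * (SC : ℤ))
    ((okAll, v - μ, bm, pP, κ, v + bm - pP - μ), (G 0, G 1, G 2))
  | some v, none => ((false, v - μ, 0, 0, -1, 0), (G 0, G 1, G 2))
  | none, _ => ((false, 0, 0, 0, 0, 0), (G 0, G 1, G 2))

/-- ★★★ **THE FUSED NEAR REPORT** with the landed value window (`valueP`). -/
def t2NearT (μ : ℤ) (c w : (Fin 3 × Fin 3) ⊕ Fin 3 → ℤ) (aP : Fin 3 → Fin 6 → ℤ) : (Bool × ℤ × ℤ × ℤ × ℤ × ℤ) × (ℤ × ℤ × ℤ) :=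
  t2NearTW 17592186044416 30 μ c w aP

/-! ## §17. The track-following FORCE FLOOR on a shuffle cell (instrument for the XI annulus scan, critic r1654 (C2)(ε3′))

Same accumulator as §14b with the shuffle CENTRE moved to `η_c + ζ_c` (put `ζ_c` into `c (inr ·)`) and the cell half-width in `w (inr ·)` (`trackW` adds the track
drift on top): on the cell `{(U, η_c + ζ_c + A·δU + ζ') : U ∈ box, |ζ'_m| ≤ w_m}` the force satisfies `|F_a| ≥ |F_a(x_c)|_lo − (j_a + h_a + r_a)`, hence
`‖F‖₂ ≥ √Σ_a ((|F_a(x_c)|_lo − j_a − h_a − r_a)⁺)²` — a kernel floor of the shuffle force over a (U-box × ζ-cell), centred at the cell's own track point. -/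

/-- `min |x|` over an interval, `SC` units (0 if the interval contains 0). -/
def fiAbsLo (I : FI) : ℤ := if I.lo ≤ 0 ∧ 0 ≤ I.hi then 0 else min |I.lo| |I.hi|

/-- ★★ **FORCE FLOOR ON A TRACK-FOLLOWING SHUFFLE CELL** `t2ForceT c w aP = (flag, (φ₀, φ₁, φ₂), (f₀ᶫ, f₁ᶫ, f₂ᶫ), (e₀, e₁, e₂))` in `SC` units: `φ_a = (f_aᶫ − e_a)⁺` with
`f_aᶫ = |F_a(x_c)|_lo` and `e_a = j_a + h_a + r_a` the §14b enclosure excess; `|F_a| ≥ φ_a/SC` on the whole cell, `‖F‖ ≥ ‖φ‖₂/SC`. -/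
def t2ForceT (c w : (Fin 3 × Fin 3) ⊕ Fin 3 → ℤ) (aP : Fin 3 → Fin 6 → ℤ) : Bool × (ℤ × ℤ × ℤ) × (ℤ × ℤ × ℤ) × (ℤ × ℤ × ℤ) :=
  let w' := trackW aP w
  let LB := nearBf c w'
  let wf : Array ℤ := Array.ofFn fun p : Fin 9 => foldW w' p
  let EF := boxE c w'
  let XF := shufFI c w'
  let EP := cenE c
  let XP := cenX c
  let A0 : AccS := ⟨true, zeroArr 3, zeroArr 18, Array.replicate 3 0, Array.replicate 3 0⟩
  let A := LB.foldl (fun A b =>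
    match mkDRec 9 EP (qB XP b), mkDRec 9 EF (qB XF b) with
    | some Rp, some Rb => accSlope aP wf Rp Rb A
    | _, _ => ⟨false, A.fc, A.jc, A.hp, A.rp⟩) A0
  let fl := fun (a : ℕ) => fiAbsLo (A.fc.getD a fi0)
  let e := fun (a : ℕ) =>
    cdiv ((List.range 6).foldl (fun s k => s + (A.jc.getD (6 * a + k) fi0).absHi * wf.getD k 0) 0) (SC : ℤ) +
      cdiv (A.hp.getD a 0) (SC : ℤ) + cdiv (A.rp.getD a 0) (2 * (SC : ℤ))
  let φ := fun (a : ℕ) => max 0 (fl a - e a)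
  (A.ok, (φ 0, φ 1, φ 2), (fl 0, fl 1, fl 2), (e 0, e 1, e 2))

end Summit.AtomisticToContinuum.Crystallization.Theorems.FrustratedLawDichotomyStrainedPatchHomValueT2Kit
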